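import Literature.MathematicalPhysics.QuantumManyBody.PeriodicFeynmanKacCell
import Literature.MathematicalPhysics.QuantumManyBody.GroundStateFeynmanKacSymmetry
import HarnessLib

/-!
# Periodic Feynman–Kac: symmetry of the torus semigroup by time reversal

Topic `Literature/MathematicalPhysics/QuantumManyBody`; theorems only (no definition, no named
fact). Support file of the proof of the named fact
`Literature.MathematicalPhysics.QuantumManyBody.BoseGas.PeriodicGroundStateFeynmanKac`
(`PeriodicHeatFlowSpectral.lean`), torus twin of `GroundStateFeynmanKacSymmetry.lean`: the
interaction-weighted functional `T_t = periodicFKSemigroup v L t` of `PeriodicHeatFlow.lean` is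
**symmetric**, both with respect to Lebesgue measure on the covering space `(ℝ³)^N`,

  `∫ f · T_t g dX = ∫ g · T_t f dX`  (measurable `f, g ≥ 0`; `lintegral_mul_periodicFKSemigroup_comm`),

and — the form the spectral theory on `L²(cell)` uses — with respect to the Haar measure of the
torus, i.e. on the fundamental cell for PERIODIC observables,

  `∫_{[0,L)^{3N}} f · T_t g = ∫_{[0,L)^{3N}} g · T_t f`  (`setLIntegral_cellN_mul_periodicFKSemigroup_comm`).

This is Step 2 of Chung–Zhao (1995), Thm 3.10 (symmetry of the Feynman–Kac semigroup (26) of a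
symmetric Hunt process — here the Brownian motion of the flat torus), proved on path space as in
the Dirichlet file: exchange `dX` and `dW`, translate the starting point by the Gaussian
displacement `√2 b_t` (on the cell: the shift invariance of cell integrals of periodic functions,
`lintegral_cellN_comp_add`, the integrand `X ↦ f(X) w_t(X,ω) g(B_t(X,ω))` being periodic), and
recognise the weight seen from the endpoint as the weight of the time-reversed world-lines, whose
family has the Wiener law (`map_pathsRev_eq`); the periodic weight has no killing factor, so only
the reflection invariance of `∫₀ᵗ` enters (`rawPeriodicWeight_pathsRev`).

## References

* K. L. Chung, Z. Zhao, *From Brownian Motion to Schrödinger's Equation* (1995), §3.2 (26),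
  Thm 3.10 (Step 2) and the Notes to Ch. 3. [ChungZhao1995]
* D. Revuz, M. Yor, *Continuous Martingales and Brownian Motion* (1999), Ch. I Ex. (1.11).
-/

noncomputable section

namespace Literature.MathematicalPhysics.QuantumManyBody.BoseGas

open MeasureTheory ProbabilityTheory Filter Set
open scoped ENNReal NNReal Topology
open Literature.Probability.Process

variable {N : ℕ}

/-! ### The raw periodic weight on the reversed paths -/

/-- **On the reversed paths, started from `Y`, the raw periodic weight on `[0, t]` is the periodic
Feynman–Kac weight of the world-lines started from `Y - √2 b_t`** (reflection invariance of
`∫₀ᵗ`; no killing factor on the torus). [folklore] -/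
theorem rawPeriodicWeight_pathsRev (v : ℝ → ℝ≥0∞) (L : ℝ) (t : ℝ≥0) (Y : Config N)
    (ω : PathSpace N) :
    expNeg (∫⁻ r in Set.Ioc (0 : ℝ) t, periodicInteraction v L (fun i : Fin N => Y i +
      WithLp.toLp 2 (fun k : Fin 3 => Real.sqrt 2 * pathRegularize
        (fun u => brownian (t - u) (ω i k) + brownian (max t u) (ω i k) - 2 * brownian t (ω i k))
          r.toNNReal))) =
    periodicFKWeight v L t
      (Y - fun i => WithLp.toLp 2 (fun k : Fin 3 => Real.sqrt 2 * brownian t (ω i k))) ω := by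
  set Z : Config N := Y - fun i => WithLp.toLp 2 (fun k : Fin 3 => Real.sqrt 2 * brownian t (ω i k))
    with hZ
  rw [periodicFKWeight, periodicPathAction,
    ← setLIntegral_Ioc_rev (fun s => periodicInteraction v L (worldLine Z ω s)) t]
  congr 1
  refine setLIntegral_congr_fun measurableSet_Ioc (fun r hr => ?_)
  rw [raw_worldLine_pathsRev Y ω (toNNReal_le_of_mem_Icc (Set.Ioc_subset_Icc_self hr))]

/-! ### The reversal identity and the symmetry on the covering space -/

/-- **Reversal identity.** Seen from the endpoint, the weighted functional is the periodic
Feynman–Kac functional: `E[w_t(Y - √2 b_t, ω) · f(Y - √2 b_t)] = (e^{-tH} f)(Y)`. [folklore] -/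
theorem lintegral_periodicFKWeight_sub_displacement {v : ℝ → ℝ≥0∞} (hv : Measurable v) (L : ℝ)
    (t : ℝ≥0) {f : Config N → ℝ≥0∞} (hf : Measurable f) (Y : Config N) :
    ∫⁻ ω, periodicFKWeight v L t (Y - fun i => WithLp.toLp 2 (fun k : Fin 3 =>
        Real.sqrt 2 * brownian t (ω i k))) ω *
      f (Y - fun i => WithLp.toLp 2 (fun k : Fin 3 => Real.sqrt 2 * brownian t (ω i k)))
        ∂wienerPaths N = periodicFKSemigroup v L t f Y := by
  -- the raw functional `H(w) = rawPeriodicWeight t Y w · f(rawWorldLine Y w t)`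
  have hH : Measurable fun w : PathSpace N =>
      expNeg (∫⁻ r in Set.Ioc (0 : ℝ) t, periodicInteraction v L (fun i : Fin N => Y i +
        WithLp.toLp 2 (fun k : Fin 3 => Real.sqrt 2 * pathRegularize (w i k) r.toNNReal))) *
      f (fun i : Fin N => Y i + WithLp.toLp 2 (fun k : Fin 3 =>
        Real.sqrt 2 * pathRegularize (w i k) t)) :=
    ((measurable_rawPeriodicWeight N hv L t).comp (measurable_const.prodMk measurable_id)).mul
      (hf.comp ((measurable_rawWorldLine_at' N t).comp (measurable_const.prodMk measurable_id)))
  -- `∫ H(rev ω) dW = ∫ H dW = ∫ H(b ω') dW`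
  have h1 := lintegral_map (μ := wienerPaths N) hH (measurable_pathsRev N t)
  have h2 := lintegral_map (μ := wienerPaths N) hH (measurable_pathsPath N)
  rw [map_pathsRev_eq] at h1
  rw [map_pathsPath_eq] at h2
  simp only [rawPeriodicWeight_pathsRev, raw_worldLine_pathsRev_self, raw_worldLine_pathsPath] at h1 h2
  rw [← h1, h2, periodicFKSemigroup, Real.toNNReal_coe]
  simp only [periodicFKWeight, periodicPathAction]

/-- Translating the starting point by the Gaussian displacement (covering space): the
`dX`-integral of `f(X) w_t(X, ω) g(B_t(X, ω))` equals the `dY`-integral of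
`g(Y) w_t(Y - √2 b_t, ω) f(Y - √2 b_t)`. [folklore] -/
theorem lintegral_translate_displacement_periodic (v : ℝ → ℝ≥0∞) (L : ℝ) (t : ℝ≥0)
    (f g : Config N → ℝ≥0∞) (ω : PathSpace N) :
    ∫⁻ X, f X * (periodicFKWeight v L t X ω * g (worldLine X ω t)) =
      ∫⁻ Y, g Y * (periodicFKWeight v L t (Y - fun i => WithLp.toLp 2 (fun k : Fin 3 =>
          Real.sqrt 2 * brownian t (ω i k))) ω *
        f (Y - fun i => WithLp.toLp 2 (fun k : Fin 3 => Real.sqrt 2 * brownian t (ω i k)))) := by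
  set c : Config N := fun i => WithLp.toLp 2 (fun k : Fin 3 => Real.sqrt 2 * brownian t (ω i k))
    with hc
  have hWL : ∀ X : Config N, worldLine X ω t = X + c := fun X => rfl
  rw [← lintegral_add_right_eq_self (μ := (volume : Measure (Config N)))
    (fun X => f X * (periodicFKWeight v L t X ω * g (worldLine X ω t))) (-c)]
  refine lintegral_congr fun Y => ?_
  simp only [hWL, ← sub_eq_add_neg, sub_add_cancel]
  ring

/-- The displacement map `(ω, Y) ↦ Y - √2 b_t(ω)` is measurable. [folklore] -/
theorem measurable_sub_displacement (t : ℝ≥0) :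
    Measurable fun p : PathSpace N × Config N => p.2 - fun i =>
      WithLp.toLp 2 (fun k : Fin 3 => Real.sqrt 2 * brownian t (p.1 i k)) :=
  measurable_snd.sub (measurable_pi_lambda _ fun i => (WithLp.measurable_toLp 2 _).comp
    (measurable_pi_lambda _ fun k => ((measurable_brownian t).const_mul _).comp
      ((measurable_pi_apply k).comp ((measurable_pi_apply i).comp measurable_fst))))

/-- **Symmetry of the periodic Feynman–Kac semigroup on the covering space.** For measurable `v`
and measurable `f, g ≥ 0`, `∫ f(X) (e^{-tH} g)(X) dX = ∫ g(X) (e^{-tH} f)(X) dX` over `(ℝ³)^N`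
(time reversal of the world-lines). Chung–Zhao (1995), Thm 3.10 (Step 2).
[cite: ChungZhao1995, Thm 3.10] -/
theorem lintegral_mul_periodicFKSemigroup_comm_nnreal {v : ℝ → ℝ≥0∞} (hv : Measurable v)
    (L : ℝ) (t : ℝ≥0) {f g : Config N → ℝ≥0∞} (hf : Measurable f) (hg : Measurable g) :
    ∫⁻ X, f X * periodicFKSemigroup v L t g X = ∫⁻ X, g X * periodicFKSemigroup v L t f X := by
  have hm1 : Measurable (Function.uncurry fun (X : Config N) (ω : PathSpace N) =>
      f X * (periodicFKWeight v L t X ω * g (worldLine X ω t))) :=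
    (hf.comp measurable_fst).mul ((measurable_periodicFKWeight_uncurry hv L t).mul
      (hg.comp (measurable_worldLine_uncurry' t)))
  have hdisp := measurable_sub_displacement (N := N) t
  have hm2 : Measurable (Function.uncurry fun (ω : PathSpace N) (Y : Config N) =>
      g Y * (periodicFKWeight v L t (Y - fun i => WithLp.toLp 2 (fun k : Fin 3 =>
          Real.sqrt 2 * brownian t (ω i k))) ω *
        f (Y - fun i => WithLp.toLp 2 (fun k : Fin 3 => Real.sqrt 2 * brownian t (ω i k))))) :=
    (hg.comp measurable_snd).mul (((measurable_periodicFKWeight_uncurry hv L t).comp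
      (hdisp.prodMk measurable_fst)).mul (hf.comp hdisp))
  calc ∫⁻ X, f X * periodicFKSemigroup v L t g X
      = ∫⁻ X, ∫⁻ ω, f X * (periodicFKWeight v L t X ω * g (worldLine X ω t)) ∂wienerPaths N := by
        refine lintegral_congr fun X => ?_
        rw [periodicFKSemigroup, Real.toNNReal_coe, lintegral_const_mul]
        exact (measurable_periodicFKWeight hv L t X).mul (hg.comp (measurable_worldLine X t))
    _ = ∫⁻ ω, ∫⁻ X, f X * (periodicFKWeight v L t X ω * g (worldLine X ω t)) ∂volume
          ∂wienerPaths N := lintegral_lintegral_swap hm1.aemeasurable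
    _ = ∫⁻ ω, ∫⁻ Y, g Y * (periodicFKWeight v L t (Y - fun i => WithLp.toLp 2 (fun k : Fin 3 =>
            Real.sqrt 2 * brownian t (ω i k))) ω *
          f (Y - fun i => WithLp.toLp 2 (fun k : Fin 3 => Real.sqrt 2 * brownian t (ω i k))))
            ∂volume ∂wienerPaths N := by
        refine lintegral_congr fun ω => ?_
        exact lintegral_translate_displacement_periodic v L t f g ω
    _ = ∫⁻ Y, ∫⁻ ω, g Y * (periodicFKWeight v L t (Y - fun i => WithLp.toLp 2 (fun k : Fin 3 =>
            Real.sqrt 2 * brownian t (ω i k))) ω *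
          f (Y - fun i => WithLp.toLp 2 (fun k : Fin 3 => Real.sqrt 2 * brownian t (ω i k))))
            ∂wienerPaths N ∂volume := lintegral_lintegral_swap hm2.aemeasurable
    _ = ∫⁻ Y, g Y * periodicFKSemigroup v L t f Y := by
        refine lintegral_congr fun Y => ?_
        have hdY : Measurable fun ω : PathSpace N => Y - fun i =>
            WithLp.toLp 2 (fun k : Fin 3 => Real.sqrt 2 * brownian t (ω i k)) :=
          hdisp.comp (measurable_id.prodMk measurable_const)
        have hmY : Measurable fun ω : PathSpace N =>
            periodicFKWeight v L t (Y - fun i => WithLp.toLp 2 (fun k : Fin 3 =>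
                Real.sqrt 2 * brownian t (ω i k))) ω *
              f (Y - fun i => WithLp.toLp 2 (fun k : Fin 3 => Real.sqrt 2 * brownian t (ω i k))) :=
          ((measurable_periodicFKWeight_uncurry hv L t).comp (hdY.prodMk measurable_id)).mul
            (hf.comp hdY)
        rw [lintegral_const_mul _ hmY, lintegral_periodicFKWeight_sub_displacement hv L t hf Y]

/-- **Symmetry of the periodic Feynman–Kac semigroup on the covering space** (real time `t ≥ 0`).
[cite: ChungZhao1995, Thm 3.10] -/
theorem lintegral_mul_periodicFKSemigroup_comm {v : ℝ → ℝ≥0∞} (hv : Measurable v) (L : ℝ)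
    {t : ℝ} (ht : 0 ≤ t) {f g : Config N → ℝ≥0∞} (hf : Measurable f) (hg : Measurable g) :
    ∫⁻ X, f X * periodicFKSemigroup v L t g X = ∫⁻ X, g X * periodicFKSemigroup v L t f X := by
  lift t to ℝ≥0 using ht
  exact lintegral_mul_periodicFKSemigroup_comm_nnreal hv L t hf hg

/-! ### The symmetry on the torus (fundamental cell, periodic observables) -/

/-- The weight is periodic in the starting point under the whole period lattice. [folklore] -/
theorem periodicFKWeight_add_latticeVecN (v : ℝ → ℝ≥0∞) (L T : ℝ) (X : Config N)
    (m : Fin N → Fin 3 → ℤ) (ω : PathSpace N) :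
    periodicFKWeight v L T (X + latticeVecN L m) ω = periodicFKWeight v L T X ω :=
  apply_add_latticeVecN_of_periodic (g := fun Z => periodicFKWeight v L T Z ω)
    (fun Z i k => periodicFKWeight_add_single v L T Z i k ω) X m

/-- Translating the starting point by the Gaussian displacement ON THE CELL: for periodic
`f, g`, the integrand `X ↦ f(X) w_t(X, ω) g(B_t(X, ω))` is periodic, so its cell integral is
invariant under the shift by `-√2 b_t(ω)` (`lintegral_cellN_comp_add`). [folklore] -/
theorem setLIntegral_cellN_translate_displacement_periodic (v : ℝ → ℝ≥0∞) {L : ℝ} (hL : 0 < L)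
    (t : ℝ≥0) {f g : Config N → ℝ≥0∞}
    (hfper : ∀ (X : Config N) (i : Fin N) (k : Fin 3),
      f (X + Pi.single i (EuclideanSpace.single k L)) = f X)
    (hgper : ∀ (X : Config N) (i : Fin N) (k : Fin 3),
      g (X + Pi.single i (EuclideanSpace.single k L)) = g X) (ω : PathSpace N) :
    ∫⁻ X in cellN N L, f X * (periodicFKWeight v L t X ω * g (worldLine X ω t)) =
      ∫⁻ Y in cellN N L, g Y * (periodicFKWeight v L t (Y - fun i => WithLp.toLp 2
          (fun k : Fin 3 => Real.sqrt 2 * brownian t (ω i k))) ω *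
        f (Y - fun i => WithLp.toLp 2 (fun k : Fin 3 => Real.sqrt 2 * brownian t (ω i k)))) := by
  set c : Config N := fun i => WithLp.toLp 2 (fun k : Fin 3 => Real.sqrt 2 * brownian t (ω i k))
    with hc
  have hWL : ∀ X : Config N, worldLine X ω t = X + c := fun X => rfl
  -- the integrand seen from the endpoint, `G(Y) = g(Y) w_t(Y - c) f(Y - c)`, is periodic
  have hGper : ∀ (Y : Config N) (i : Fin N) (k : Fin 3),
      g (Y + Pi.single i (EuclideanSpace.single k L)) *
          (periodicFKWeight v L t (Y + Pi.single i (EuclideanSpace.single k L) - c) ω *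
            f (Y + Pi.single i (EuclideanSpace.single k L) - c)) =
        g Y * (periodicFKWeight v L t (Y - c) ω * f (Y - c)) := by
    intro Y i k
    rw [hgper, add_sub_right_comm, periodicFKWeight_add_single, hfper]
  -- `∫_cell G(X + c) dX = ∫_cell G(Y) dY`, and `G(X + c) = f(X) w_t(X) g(X + c)`
  have h := lintegral_cellN_comp_add hL
    (G := fun Y => g Y * (periodicFKWeight v L t (Y - c) ω * f (Y - c))) hGper c
  simp only [add_sub_cancel_right] at h
  rw [← h]
  refine lintegral_congr fun X => ?_
  rw [hWL]
  ring

/-- **Symmetry of the periodic Feynman–Kac semigroup on the torus.** For `L > 0`, measurable `v`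
and measurable `f, g ≥ 0` that are `Lℤ³`-periodic in every particle,
`∫_{[0,L)^{3N}} f · (e^{-tH} g) = ∫_{[0,L)^{3N}} g · (e^{-tH} f)` (`t : ℝ≥0`): the Feynman–Kac
semigroup (26) of the Brownian motion of the flat torus is symmetric with respect to its Haar
measure. Chung–Zhao (1995), Thm 3.10 (Step 2). [cite: ChungZhao1995, Thm 3.10] -/
theorem setLIntegral_cellN_mul_periodicFKSemigroup_comm_nnreal {v : ℝ → ℝ≥0∞} (hv : Measurable v)
    {L : ℝ} (hL : 0 < L) (t : ℝ≥0) {f g : Config N → ℝ≥0∞} (hf : Measurable f) (hg : Measurable g)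
    (hfper : ∀ (X : Config N) (i : Fin N) (k : Fin 3),
      f (X + Pi.single i (EuclideanSpace.single k L)) = f X)
    (hgper : ∀ (X : Config N) (i : Fin N) (k : Fin 3),
      g (X + Pi.single i (EuclideanSpace.single k L)) = g X) :
    ∫⁻ X in cellN N L, f X * periodicFKSemigroup v L t g X =
      ∫⁻ X in cellN N L, g X * periodicFKSemigroup v L t f X := by
  have hm1 : Measurable (Function.uncurry fun (X : Config N) (ω : PathSpace N) =>
      f X * (periodicFKWeight v L t X ω * g (worldLine X ω t))) :=
    (hf.comp measurable_fst).mul ((measurable_periodicFKWeight_uncurry hv L t).mul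
      (hg.comp (measurable_worldLine_uncurry' t)))
  have hdisp := measurable_sub_displacement (N := N) t
  have hm2 : Measurable (Function.uncurry fun (ω : PathSpace N) (Y : Config N) =>
      g Y * (periodicFKWeight v L t (Y - fun i => WithLp.toLp 2 (fun k : Fin 3 =>
          Real.sqrt 2 * brownian t (ω i k))) ω *
        f (Y - fun i => WithLp.toLp 2 (fun k : Fin 3 => Real.sqrt 2 * brownian t (ω i k))))) :=
    (hg.comp measurable_snd).mul (((measurable_periodicFKWeight_uncurry hv L t).comp
      (hdisp.prodMk measurable_fst)).mul (hf.comp hdisp))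
  calc ∫⁻ X in cellN N L, f X * periodicFKSemigroup v L t g X
      = ∫⁻ X in cellN N L, ∫⁻ ω, f X * (periodicFKWeight v L t X ω * g (worldLine X ω t))
          ∂wienerPaths N := by
        refine lintegral_congr fun X => ?_
        rw [periodicFKSemigroup, Real.toNNReal_coe, lintegral_const_mul]
        exact (measurable_periodicFKWeight hv L t X).mul (hg.comp (measurable_worldLine X t))
    _ = ∫⁻ ω, ∫⁻ X in cellN N L, f X * (periodicFKWeight v L t X ω * g (worldLine X ω t)) ∂volume
          ∂wienerPaths N := lintegral_lintegral_swap hm1.aemeasurable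
    _ = ∫⁻ ω, ∫⁻ Y in cellN N L, g Y * (periodicFKWeight v L t (Y - fun i => WithLp.toLp 2
            (fun k : Fin 3 => Real.sqrt 2 * brownian t (ω i k))) ω *
          f (Y - fun i => WithLp.toLp 2 (fun k : Fin 3 => Real.sqrt 2 * brownian t (ω i k))))
            ∂volume ∂wienerPaths N := by
        refine lintegral_congr fun ω => ?_
        exact setLIntegral_cellN_translate_displacement_periodic v hL t hfper hgper ω
    _ = ∫⁻ Y in cellN N L, ∫⁻ ω, g Y * (periodicFKWeight v L t (Y - fun i => WithLp.toLp 2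
            (fun k : Fin 3 => Real.sqrt 2 * brownian t (ω i k))) ω *
          f (Y - fun i => WithLp.toLp 2 (fun k : Fin 3 => Real.sqrt 2 * brownian t (ω i k))))
            ∂wienerPaths N ∂volume := lintegral_lintegral_swap hm2.aemeasurable
    _ = ∫⁻ Y in cellN N L, g Y * periodicFKSemigroup v L t f Y := by
        refine lintegral_congr fun Y => ?_
        have hdY : Measurable fun ω : PathSpace N => Y - fun i =>
            WithLp.toLp 2 (fun k : Fin 3 => Real.sqrt 2 * brownian t (ω i k)) :=
          hdisp.comp (measurable_id.prodMk measurable_const)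
        have hmY : Measurable fun ω : PathSpace N =>
            periodicFKWeight v L t (Y - fun i => WithLp.toLp 2 (fun k : Fin 3 =>
                Real.sqrt 2 * brownian t (ω i k))) ω *
              f (Y - fun i => WithLp.toLp 2 (fun k : Fin 3 => Real.sqrt 2 * brownian t (ω i k))) :=
          ((measurable_periodicFKWeight_uncurry hv L t).comp (hdY.prodMk measurable_id)).mul
            (hf.comp hdY)
        rw [lintegral_const_mul _ hmY, lintegral_periodicFKWeight_sub_displacement hv L t hf Y]

/-- **Symmetry of the periodic Feynman–Kac semigroup on the torus** (real time `t ≥ 0`): for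
periodic measurable `f, g ≥ 0`, `∫_cell f · (e^{-tH} g) = ∫_cell g · (e^{-tH} f)`.
[cite: ChungZhao1995, Thm 3.10] -/
theorem setLIntegral_cellN_mul_periodicFKSemigroup_comm {v : ℝ → ℝ≥0∞} (hv : Measurable v)
    {L : ℝ} (hL : 0 < L) {t : ℝ} (ht : 0 ≤ t) {f g : Config N → ℝ≥0∞} (hf : Measurable f)
    (hg : Measurable g)
    (hfper : ∀ (X : Config N) (i : Fin N) (k : Fin 3),
      f (X + Pi.single i (EuclideanSpace.single k L)) = f X)
    (hgper : ∀ (X : Config N) (i : Fin N) (k : Fin 3),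
      g (X + Pi.single i (EuclideanSpace.single k L)) = g X) :
    ∫⁻ X in cellN N L, f X * periodicFKSemigroup v L t g X =
      ∫⁻ X in cellN N L, g X * periodicFKSemigroup v L t f X := by
  lift t to ℝ≥0 using ht
  exact setLIntegral_cellN_mul_periodicFKSemigroup_comm_nnreal hv hL t hf hg hfper hgper

/-- **The periodic functional of a periodic observable is periodic** (`[0,∞]`-valued form of
`periodicHeatFlow_add_single_of_periodic`). [folklore] -/
theorem periodicFKSemigroup_add_single_of_periodic (v : ℝ → ℝ≥0∞) (L T : ℝ) {g : Config N → ℝ≥0∞}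
    (hper : ∀ (X : Config N) (i : Fin N) (k : Fin 3),
      g (X + Pi.single i (EuclideanSpace.single k L)) = g X)
    (X : Config N) (i : Fin N) (k : Fin 3) :
    periodicFKSemigroup v L T g (X + Pi.single i (EuclideanSpace.single k L)) =
      periodicFKSemigroup v L T g X := by
  rw [periodicFKSemigroup_add_single]
  simp only [hper]

end Literature.MathematicalPhysics.QuantumManyBody.BoseGas

end
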